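import Literature.AlgebraicGeometry.Motives.HodgeThetaSubalgebraUnitaryRankIdempotent
import HarnessLib

/-!
# A full-rank raising/lowering pair exists for `dim P = 2` and ANY `dim Q ≥ 2` in an irreducible `Θ`-subalgebra
# (Ribet 1983 Thm. 3 beyond coprime multiplicities — the `(2,4)` complex core, second brick; Moonen–Zarhin 1999 (2.3)–(2.4))

Topic `Literature/AlgebraicGeometry/Motives` (pure complex linear algebra; no geometry).  Theorems only (no definition, no named
fact; D-0026).  Written for the cell `pub-hodgeav-hg6` (req-37 (A) row 2, TABLE X row 8-`(4,2)`; brick U2b of the `(4,2)` programme;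
honest framing of that cell: HC / HC_AV / HC_CM / H2 NOT proved — THIS file is unconditional linear algebra and discharges no
hypothesis of the cell's cover).

SETTING (as in `HodgeThetaSubalgebraUnitaryCoprimeCore` §5).  `W` finite-dimensional over `ℂ`; `𝔊 ⊆ End(W)` a `ℂ`-subspace closed
under the commutator, acting IRREDUCIBLY on `W`; `Θ ∈ 𝔊` with `Θ² = 1`, `P = {Θ = 1}` of dimension `2`, `Q = {Θ = −1}` of dimension
`≥ 2`.  Raising operators `B` (`ΘB = B = −BΘ`) map `Q → P` and kill `P`; lowering operators `C` map `P → Q` and kill `Q`.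

* **`UnitaryThetaCore.exists_fullRank_pair_two`** — there are a raising `B ∈ 𝔊` and a lowering `C ∈ 𝔊` with `BC|_P` injective.
  The tree's `UnitaryThetaCore.exists_fullRank_pair` is the case `dim Q = 3`, whose endgame uses the codimension-ONE complement
  `Q = C(P) ⊕ ℂq′` twice; here that endgame is replaced by a BRACKET COMPUTATION valid for every `dim Q ≥ 2`, the first two steps
  being the (2,3) file's (pencil lemma `apply_mem_span_of_pencil`, covering facts `mem_span_raise_apply` /
  `eq_zero_of_forall_raise_apply_eq_zero`, injective lowering `exists_lower_injOn`, the pencil count).  PROOF: suppose no full-rank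
  pair.  (1) For a lowering `C` injective on `P`, all raising operators map `Π = C(P)` into one line `ℓ = ℂa` (pencil lemma).
  (2) Some raising `B₀` and lowering `C″`, `p″ ∈ P` have `B₀(C″p″) ∉ ℓ` (raising values span `P`, lowering values span `Q`); for all
  but `≤ 2` values of `t` the lowering `C′ = C + tC″` is injective on `P` (pencil count), and `B₀(C′p″) ∉ ℓ`; by (1) for `C′` all
  raising operators map `C′(P)` into a line `ℓ′ = ℂa′`, and `ℓ ∩ ℓ′ = 0`.  (3) For a raising `B`, `D := [B, C] ∈ 𝔊` commutes with
  `Θ`, and since `B² = 0` the raising operator `X := [D, B] ∈ 𝔊` is `2·BCB`; writing `B(C′p) = φ′_B(p)·a′` one gets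
  `X(C′p) = 2 φ′_B(p) · B(C a′) ∈ ℓ`, while `X(C′p) ∈ ℓ′` by (2): so `φ′_B(p) · B(C a′) = 0` for all `p`, i.e. EVERY raising `B`
  kills `C a′` or kills `C′(P)`.  (4) A vector space is not the union of two proper subspaces: all
  raising operators kill the non-zero vector `C a′ ∈ Q`, or all kill `C′(P) ≠ 0` — either way the covering fact
  `eq_zero_of_forall_raise_apply_eq_zero` is contradicted.
WHY (the `(2,4)` programme): with `1 ∈ 𝔊` and `dim Q = dim P + 2`, `UnitaryThetaCore.exists_idempotent_of_fullRank_pair` (U2a) now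
PRODUCES rank-two idempotents `E_{B,C} ∈ 𝔊` (ranges `Q ∩ ker CB`), the objects of the intended dichotomy of the open core U2
(`HOME/jobs/CRUX-42-eng5g4/CruxFourTwo.lean` of the cell).

## References

* [Ribet1983] K. A. Ribet, *Hodge classes on certain types of abelian varieties*, Amer. J. Math. 105 (1983), Thm. 3.
* [Gordon1997] B. B. Gordon, *A survey of the Hodge conjecture for abelian varieties*, §6 (proof of Thm. 6.3.3, p. 19).
* [MoonenZarhin1999LowDim] B. Moonen, Yu. Zarhin, Math. Ann. 315 (1999), §2 (2.3)–(2.4).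
* [GoodmanWallachGTM255] R. Goodman, N. Wallach, *Symmetry, Representations, and Invariants*, §4.1.1 (gradings).
-/

noncomputable section

open Module

namespace Literature.AlgebraicGeometry.Motives

namespace HodgeStructure

section FullRank

variable {W : Type*} [AddCommGroup W] [Module ℂ W]

/-- Coordinates on a plane with respect to two independent vectors (the (2,3) file's private `exists_pair_coords_of_not_mem`,
re-proved here because it is private there). [folklore] -/
private theorem UnitaryThetaCore.exists_pair_coords_of_not_mem₂ [FiniteDimensional ℂ W] {P : Submodule ℂ W}
    (hP2 : Module.finrank ℂ P = 2) {a b : W} (ha : a ∈ P) (hb : b ∈ P) (ha0 : a ≠ 0) (hba : b ∉ ℂ ∙ a)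
    {x : W} (hx : x ∈ P) : ∃ s r : ℂ, x = s • a + r • b := by
  have hli : LinearIndependent ℂ ![(⟨a, ha⟩ : P), ⟨b, hb⟩] := by
    rw [LinearIndependent.pair_iff' (fun h => ha0 (congrArg Subtype.val h))]
    intro c hc
    exact hba (Submodule.mem_span_singleton.2 ⟨c, by simpa using congrArg Subtype.val hc⟩)
  have hspan := hli.span_eq_top_of_card_eq_finrank (by rw [Fintype.card_fin, hP2])
  have hmem : (⟨x, hx⟩ : P) ∈ Submodule.span ℂ (Set.range ![(⟨a, ha⟩ : P), ⟨b, hb⟩]) := by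
    rw [hspan]; exact Submodule.mem_top
  obtain ⟨c, hc⟩ := (Submodule.mem_span_range_iff_exists_fun ℂ).1 hmem
  refine ⟨c 0, c 1, ?_⟩
  have h := congrArg Subtype.val hc
  simp only [Fin.sum_univ_two, Matrix.cons_val_zero, Matrix.cons_val_one, Submodule.coe_add,
    Submodule.coe_smul] at h
  exact h.symm

set_option maxHeartbeats 1600000 in
/-- **A FULL-RANK PAIR EXISTS for `dim P = 2` and any `dim Q ≥ 2`**: for `W` irreducible under a bracket-closed `𝔊 ∋ Θ` (`Θ² = 1`)
with `dim P = 2 ≤ dim Q`, some raising `B ∈ 𝔊` and lowering `C ∈ 𝔊` have `BC|_P` injective.  (Module docstring: pencil lines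
`ℓ ≠ ℓ′` of two injective lowerings, then the raising operator `[[B, C], B]` maps `C′(P)` into `ℓ ∩ ℓ′ = 0`, forcing every raising
operator to kill `C a′` or `C′(P)`, against the covering fact.)  Generalises the tree's `UnitaryThetaCore.exists_fullRank_pair`
(`dim Q = 3`). [cite: Ribet1983, Thm. 3] [cite: Gordon1997, §6 (proof of Thm. 6.3.3, p. 19)] [cite: MoonenZarhin1999LowDim, §2 (2.4)]
[cite: GoodmanWallachGTM255, §4.1.1] -/
theorem UnitaryThetaCore.exists_fullRank_pair_two [FiniteDimensional ℂ W] {𝔊 : Submodule ℂ (Module.End ℂ W)}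
    (hbr : ∀ Y ∈ 𝔊, ∀ Z ∈ 𝔊, Y * Z - Z * Y ∈ 𝔊)
    (hirr : ∀ U : Submodule ℂ W, (∀ A ∈ 𝔊, ∀ u ∈ U, A u ∈ U) → U = ⊥ ∨ U = ⊤)
    {Θ : Module.End ℂ W} (hΘ : Θ ∈ 𝔊) (hΘΘ : Θ * Θ = 1)
    {P Q : Submodule ℂ W} (hP : ∀ x, x ∈ P ↔ Θ x = x) (hQ : ∀ x, x ∈ Q ↔ Θ x = -x)
    (hP2 : Module.finrank ℂ P = 2) (hQ2 : 2 ≤ Module.finrank ℂ Q) :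
    ∃ B ∈ 𝔊, ∃ C ∈ 𝔊, Θ * B = B ∧ B * Θ = -B ∧ Θ * C = -C ∧ C * Θ = C ∧ ∀ p ∈ P, B (C p) = 0 → p = 0 := by
  classical
  have hΘΘv : ∀ v, Θ (Θ v) = v := fun v => by rw [← Module.End.mul_apply, hΘΘ, Module.End.one_apply]
  have hnΘ : -Θ ∈ 𝔊 := Submodule.neg_mem _ hΘ
  have hnΘΘ : (-Θ) * (-Θ) = 1 := by rw [neg_mul_neg, hΘΘ]
  -- kill / into lemmas
  have hraiseP : ∀ B : Module.End ℂ W, B * Θ = -B → ∀ p ∈ P, B p = 0 := fun B hBΘ p hp => by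
    have h : B p = -(B p) := by
      conv_lhs => rw [← (hP p).1 hp]
      rw [← Module.End.mul_apply, hBΘ, LinearMap.neg_apply]
    have h2 : (2 : ℂ) • B p = 0 := by rw [two_smul]; nth_rewrite 2 [h]; rw [add_neg_cancel]
    exact (smul_eq_zero.1 h2).resolve_left two_ne_zero
  have hlowerQ : ∀ C : Module.End ℂ W, C * Θ = C → ∀ q ∈ Q, C q = 0 := fun C hCΘ q hq => by
    have h : C q = -(C q) := by
      conv_lhs => rw [← neg_neg q, ← (hQ q).1 hq, map_neg, ← Module.End.mul_apply, hCΘ]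
    have h2 : (2 : ℂ) • C q = 0 := by rw [two_smul]; nth_rewrite 2 [h]; rw [add_neg_cancel]
    exact (smul_eq_zero.1 h2).resolve_left two_ne_zero
  have hraise_into : ∀ B : Module.End ℂ W, Θ * B = B → ∀ w, B w ∈ P := fun B hΘB w =>
    (hP _).2 (by rw [← Module.End.mul_apply, hΘB])
  have hlower_into : ∀ C : Module.End ℂ W, Θ * C = -C → ∀ w, C w ∈ Q := fun C hΘC w =>
    (hQ _).2 (by rw [← Module.End.mul_apply, hΘC, LinearMap.neg_apply])
  have hPhat : ∀ w, (2 : ℂ)⁻¹ • (w + Θ w) ∈ P := fun w => (hP _).2 (by rw [map_smul, map_add, hΘΘv, add_comm])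
  have hQhat : ∀ w, (2 : ℂ)⁻¹ • (w - Θ w) ∈ Q := fun w =>
    (hQ _).2 (by rw [map_smul, map_sub, hΘΘv, ← smul_neg, neg_sub])
  have hsplit : ∀ w, (2 : ℂ)⁻¹ • (w + Θ w) + (2 : ℂ)⁻¹ • (w - Θ w) = w := fun w => by module
  -- non-zero vectors
  obtain ⟨p₀, hp₀P, hp₀0⟩ : ∃ p₀ ∈ P, p₀ ≠ 0 := by
    by_contra hne
    push Not at hne
    have : P = ⊥ := by rw [eq_bot_iff]; intro x hx; rw [Submodule.mem_bot]; exact hne x hx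
    rw [this, finrank_bot] at hP2; exact two_ne_zero hP2.symm
  obtain ⟨q₀, hq₀Q, hq₀0⟩ : ∃ q₀ ∈ Q, q₀ ≠ 0 := by
    by_contra hne
    push Not at hne
    have : Q = ⊥ := by rw [eq_bot_iff]; intro x hx; rw [Submodule.mem_bot]; exact hne x hx
    rw [this, finrank_bot] at hQ2; exact absurd hQ2 (by norm_num)
  -- covering facts packaged
  have h1b : ∀ q ∈ Q, q ≠ 0 → ∃ B ∈ 𝔊, Θ * B = B ∧ B * Θ = -B ∧ B q ≠ 0 := by
    intro q hq hq0
    by_contra hne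
    push Not at hne
    exact hq0 (UnitaryThetaCore.eq_zero_of_forall_raise_apply_eq_zero hbr hirr hΘ hΘΘ
      ⟨p₀, hp₀0, (hP p₀).1 hp₀P⟩ ((hQ q).1 hq) fun B hB h1 h2 => hne B hB h1 h2)
  have h1a : ∀ y ∈ P, y ∈ Submodule.span ℂ {x : W | ∃ B ∈ 𝔊, Θ * B = B ∧ B * Θ = -B ∧ ∃ w, B w = x} := fun y hy =>
    UnitaryThetaCore.mem_span_raise_apply hbr hirr hΘ hΘΘ ⟨q₀, hq₀0, (hQ q₀).1 hq₀Q⟩ ((hP y).1 hy)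
  have h1c : ∀ y ∈ Q, y ∈ Submodule.span ℂ {x : W | ∃ C ∈ 𝔊, Θ * C = -C ∧ C * Θ = C ∧ ∃ w, C w = x} := by
    intro y hy
    have h := UnitaryThetaCore.mem_span_raise_apply hbr hirr hnΘ hnΘΘ
      ⟨p₀, hp₀0, by rw [LinearMap.neg_apply, (hP p₀).1 hp₀P]⟩
      (y := y) (by rw [LinearMap.neg_apply, (hQ y).1 hy, neg_neg])
    refine Submodule.span_mono ?_ h
    rintro x ⟨B, hB, h1, h2, w, rfl⟩
    exact ⟨B, hB, by rwa [neg_mul, neg_eq_iff_eq_neg] at h1, by rwa [mul_neg, neg_inj] at h2, w, rfl⟩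
  by_contra hno
  push Not at hno
  -- `hno : ∀ B ∈ 𝔊, ∀ C ∈ 𝔊, ΘB = B → BΘ = -B → ΘC = -C → CΘ = C → ∃ p ∈ P, B (C p) = 0 ∧ p ≠ 0`
  -- (1): for a lowering `C'` injective on `P`, all `B(C'P)` lie on one line `ℂa`, `0 ≠ a ∈ P`
  have hB1 : ∀ C' ∈ 𝔊, Θ * C' = -C' → C' * Θ = C' → (∀ p ∈ P, C' p = 0 → p = 0) →
      ∃ a ∈ P, a ≠ 0 ∧ ∀ B ∈ 𝔊, Θ * B = B → B * Θ = -B → ∀ p ∈ P, B (C' p) ∈ ℂ ∙ a := by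
    intro C' hC' hΘC' hC'Θ hinj'
    set 𝓕 : Set (Module.End ℂ W) := {A | ∃ B ∈ 𝔊, Θ * B = B ∧ B * Θ = -B ∧ A = B * C'} with h𝓕
    have hadd : ∀ A ∈ 𝓕, ∀ A' ∈ 𝓕, A + A' ∈ 𝓕 := by
      rintro _ ⟨B, hB, h1, h2, rfl⟩ _ ⟨B', hB', h1', h2', rfl⟩
      exact ⟨B + B', Submodule.add_mem _ hB hB', by rw [mul_add, h1, h1'], by rw [add_mul, h2, h2', neg_add],
        by rw [add_mul]⟩
    have hsing : ∀ A ∈ 𝓕, ∃ p ∈ P, p ≠ 0 ∧ A p = 0 := by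
      rintro _ ⟨B, hB, h1, h2, rfl⟩
      obtain ⟨p, hp, hBCp, hp0⟩ := hno B hB C' hC' h1 h2 hΘC' hC'Θ
      exact ⟨p, hp, hp0, by rw [Module.End.mul_apply, hBCp]⟩
    have hcov : ∀ p ∈ P, p ≠ 0 → ∃ A ∈ 𝓕, A p ≠ 0 := by
      intro p hp hp0
      have hC'p : C' p ≠ 0 := fun h => hp0 (hinj' p hp h)
      obtain ⟨B, hB, h1, h2, hBq⟩ := h1b (C' p) (hlower_into C' hΘC' p) hC'p
      exact ⟨B * C', ⟨B, hB, h1, h2, rfl⟩, by rwa [Module.End.mul_apply]⟩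
    obtain ⟨A₁, hA₁, hA₁p₀⟩ := hcov p₀ hp₀P hp₀0
    have hℓ := UnitaryThetaCore.apply_mem_span_of_pencil hP2 𝓕 hadd hsing hcov hA₁ hp₀P hA₁p₀
    obtain ⟨B₁, hB₁, hΘB₁, -, rfl⟩ := hA₁
    refine ⟨(B₁ * C') p₀, hraise_into _ (by rw [← mul_assoc, hΘB₁]) p₀, hA₁p₀, fun B hB h1 h2 p hp => ?_⟩
    have := hℓ (B * C') ⟨B, hB, h1, h2, rfl⟩ p hp
    rwa [Module.End.mul_apply] at this
  -- an injective lowering `C`, its line `ℓ = ℂa`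
  obtain ⟨C, hC, hΘC, hCΘ, hCinj⟩ :=
    UnitaryThetaCore.exists_lower_injOn hbr hirr hΘ hΘΘ hP hQ hP2 hQ2
  obtain ⟨a, haP, ha0, hℓ⟩ := hB1 C hC hΘC hCΘ hCinj
  -- `B₀` raising and `q' ∈ Q` with `B₀ q' ∉ ℓ`
  obtain ⟨B₀, hB₀, hΘB₀, hB₀Θ, q', hq'Q, hB₀q'⟩ :
      ∃ B₀ ∈ 𝔊, Θ * B₀ = B₀ ∧ B₀ * Θ = -B₀ ∧ ∃ q' ∈ Q, B₀ q' ∉ ℂ ∙ a := by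
    by_contra hne
    push Not at hne
    have hPle : P ≤ ℂ ∙ a := by
      intro y hy
      refine (Submodule.span_le.2 ?_) (h1a y hy)
      rintro _ ⟨B, hB, h1, h2, w, rfl⟩
      rw [← hsplit w, map_add, hraiseP B h2 _ (hPhat w), zero_add]
      exact hne B hB h1 h2 _ (hQhat w)
    have := (Submodule.finrank_mono hPle).trans (finrank_span_singleton ha0).le
    omega
  -- (2): a lowering `C''` and `p'' ∈ P` with `B₀ (C'' p'') ∉ ℓ` (lowering values span `Q ∋ q'`)
  obtain ⟨C'', hC'', hΘC'', hC''Θ, p'', hp''P, hC''p''⟩ :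
      ∃ C'' ∈ 𝔊, Θ * C'' = -C'' ∧ C'' * Θ = C'' ∧ ∃ p'' ∈ P, B₀ (C'' p'') ∉ ℂ ∙ a := by
    by_contra hne
    push Not at hne
    apply hB₀q'
    have hle : Submodule.span ℂ {x : W | ∃ C ∈ 𝔊, Θ * C = -C ∧ C * Θ = C ∧ ∃ w, C w = x} ≤ (ℂ ∙ a).comap B₀ := by
      rw [Submodule.span_le]
      rintro _ ⟨C₁, hC₁, h1, h2, w, rfl⟩
      rw [SetLike.mem_coe, Submodule.mem_comap, ← hsplit w, map_add, hlowerQ C₁ h2 _ (hQhat w), add_zero]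
      exact hne C₁ hC₁ h1 h2 _ (hPhat w)
    exact hle (h1c q' hq'Q)
  have hC''p''Pi : C'' p'' ∉ P.map C := by
    rintro ⟨p, hp, hpe⟩
    exact hC''p'' (hpe ▸ hℓ B₀ hB₀ hΘB₀ hB₀Θ p hp)
  -- the pencil `C_t = C + t C''`: at most two bad values of `t`
  have hCt : ∀ t : ℂ, C + t • C'' ∈ 𝔊 ∧ Θ * (C + t • C'') = -(C + t • C'') ∧ (C + t • C'') * Θ = C + t • C'' :=
    fun t => ⟨Submodule.add_mem _ hC (Submodule.smul_mem _ t hC''),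
      by rw [mul_add, mul_smul_comm, hΘC, hΘC'', smul_neg, neg_add],
      by rw [add_mul, smul_mul_assoc, hCΘ, hC''Θ]⟩
  have hbad : ∀ t₁ t₂ : ℂ, t₁ ≠ 0 → t₂ ≠ 0 → t₁ ≠ t₂ →
      (∃ p ∈ P, p ≠ 0 ∧ (C + t₁ • C'') p = 0) → (∃ p ∈ P, p ≠ 0 ∧ (C + t₂ • C'') p = 0) → False := by
    rintro t₁ t₂ ht₁ ht₂ hne ⟨p₁, hp₁P, hp₁0, hp₁⟩ ⟨p₂, hp₂P, hp₂0, hp₂⟩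
    rw [LinearMap.add_apply, LinearMap.smul_apply, add_eq_zero_iff_eq_neg] at hp₁ hp₂
    have hmemPi : ∀ (t : ℂ) (p : W), t ≠ 0 → p ∈ P → C p = -(t • C'' p) → C'' p ∈ P.map C := fun t p ht hp h =>
      ⟨-(t⁻¹) • p, Submodule.smul_mem _ _ hp, by rw [map_smul, h, neg_smul, smul_neg, neg_neg, smul_smul,
        inv_mul_cancel₀ ht, one_smul]⟩
    have h1 := hmemPi t₁ p₁ ht₁ hp₁P hp₁
    have h2 := hmemPi t₂ p₂ ht₂ hp₂P hp₂
    by_cases hdep : p₂ ∈ ℂ ∙ p₁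
    · obtain ⟨c, rfl⟩ := Submodule.mem_span_singleton.1 hdep
      have hc : c ≠ 0 := by rintro rfl; exact hp₂0 (zero_smul _ _)
      rw [map_smul, map_smul, smul_comm t₂ c, ← smul_neg] at hp₂
      have hp₂' := smul_right_injective W hc hp₂
      have h : (t₁ - t₂) • C'' p₁ = 0 := by
        rw [sub_smul, sub_eq_zero]
        have := hp₁.symm.trans hp₂'
        exact neg_inj.1 this
      rw [smul_eq_zero] at h
      rcases h with h | h
      · exact hne (sub_eq_zero.1 h)
      · rw [h, smul_zero, neg_zero] at hp₁
        exact hp₁0 (hCinj p₁ hp₁P hp₁)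
    · obtain ⟨s, r, hsr⟩ := UnitaryThetaCore.exists_pair_coords_of_not_mem₂ hP2 hp₁P hp₂P hp₁0 hdep hp''P
      apply hC''p''Pi
      rw [hsr, map_add, map_smul, map_smul]
      exact Submodule.add_mem _ (Submodule.smul_mem _ _ h1) (Submodule.smul_mem _ _ h2)
  have hgood_or : ∀ t₁ t₂ : ℂ, t₁ ≠ 0 → t₂ ≠ 0 → t₁ ≠ t₂ →
      (∀ p ∈ P, (C + t₁ • C'') p = 0 → p = 0) ∨ (∀ p ∈ P, (C + t₂ • C'') p = 0 → p = 0) := by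
    intro t₁ t₂ ht₁ ht₂ hne
    by_contra h
    rw [not_or] at h
    obtain ⟨h1, h2⟩ := h
    push Not at h1 h2
    obtain ⟨p₁, hp₁, hq₁, hp₁0⟩ := h1
    obtain ⟨p₂, hp₂, hq₂, hp₂0⟩ := h2
    exact hbad t₁ t₂ ht₁ ht₂ hne ⟨p₁, hp₁, hp₁0, hq₁⟩ ⟨p₂, hp₂, hp₂0, hq₂⟩
  obtain ⟨t, ht0, hgt⟩ : ∃ t : ℂ, t ≠ 0 ∧ ∀ p ∈ P, (C + t • C'') p = 0 → p = 0 := by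
    rcases hgood_or 1 2 one_ne_zero two_ne_zero (by norm_num) with g1 | g2
    · exact ⟨1, one_ne_zero, g1⟩
    · exact ⟨2, two_ne_zero, g2⟩
  -- `C' := C + t C''` is injective on `P` and `B₀ (C' p'') ∉ ℓ`
  set C' : Module.End ℂ W := C + t • C'' with hC'def
  have hC' : C' ∈ 𝔊 := (hCt t).1
  have hΘC' : Θ * C' = -C' := (hCt t).2.1
  have hC'Θ : C' * Θ = C' := (hCt t).2.2
  have hC'inj : ∀ p ∈ P, C' p = 0 → p = 0 := hgt
  have hB₀C'p'' : B₀ (C' p'') ∉ ℂ ∙ a := by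
    intro hmem
    rw [hC'def, LinearMap.add_apply, LinearMap.smul_apply, map_add, map_smul] at hmem
    have h := Submodule.sub_mem _ hmem (hℓ B₀ hB₀ hΘB₀ hB₀Θ p'' hp''P)
    rw [add_sub_cancel_left] at h
    exact hC''p'' ((Submodule.smul_mem_iff _ ht0).1 h)
  -- the line `ℓ' = ℂa'` of `C'`; `ℓ ∩ ℓ' = 0`
  obtain ⟨a', ha'P, ha'0, hℓ'⟩ := hB1 C' hC' hΘC' hC'Θ hC'inj
  have hmeet : ∀ x, x ∈ ℂ ∙ a' → x ∈ ℂ ∙ a → x = 0 := by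
    intro x hx hxa
    obtain ⟨c, rfl⟩ := Submodule.mem_span_singleton.1 hx
    by_cases hc : c = 0
    · rw [hc, zero_smul]
    · exfalso
      have ha' : a' ∈ ℂ ∙ a := (Submodule.smul_mem_iff _ hc).1 hxa
      exact hB₀C'p'' ((Submodule.span_singleton_le_iff_mem a' _).2 ha' (hℓ' B₀ hB₀ hΘB₀ hB₀Θ p'' hp''P))
  -- (3): the bracket computation — every raising `B` kills `C a'` or kills `C'(P)`
  have hkey : ∀ B ∈ 𝔊, Θ * B = B → B * Θ = -B → B (C a') = 0 ∨ ∀ p ∈ P, B (C' p) = 0 := by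
    intro B hB hΘB hBΘ
    -- `D = [B, C]`, `X = [D, B]`
    have hD : B * C - C * B ∈ 𝔊 := hbr B hB C hC
    have hX : (B * C - C * B) * B - B * (B * C - C * B) ∈ 𝔊 := hbr _ hD B hB
    have hBB : B * B = 0 := UnitaryThetaCore.mul_self_eq_zero_of_raise hΘB hBΘ
    -- `X = 2·BCB` since `B² = 0`; hence `X` is raising
    have hX2 : (B * C - C * B) * B - B * (B * C - C * B) = (2 : ℂ) • (B * C * B) := by
      rw [sub_mul, mul_sub, mul_assoc C B B, hBB, mul_zero, sub_zero, ← mul_assoc B B C, hBB, zero_mul, zero_sub,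
        ← mul_assoc B C B, sub_neg_eq_add, two_smul]
    have hΘX : Θ * ((B * C - C * B) * B - B * (B * C - C * B)) = (B * C - C * B) * B - B * (B * C - C * B) := by
      rw [hX2, mul_smul_comm, ← mul_assoc, ← mul_assoc, hΘB]
    have hXΘ : ((B * C - C * B) * B - B * (B * C - C * B)) * Θ = -((B * C - C * B) * B - B * (B * C - C * B)) := by
      rw [hX2, smul_mul_assoc, mul_assoc (B * C) B Θ, hBΘ, mul_neg, smul_neg]
    -- scalars `φ'(p)`, `φ(a')`
    by_cases hBCa' : B (C a') = 0
    · exact Or.inl hBCa'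
    · right
      intro p hp
      obtain ⟨c₁, hc₁⟩ := Submodule.mem_span_singleton.1 (hℓ' B hB hΘB hBΘ p hp)    -- `B (C' p) = c₁ • a'`
      obtain ⟨c₂, hc₂⟩ := Submodule.mem_span_singleton.1 (hℓ B hB hΘB hBΘ a' ha'P)  -- `B (C a') = c₂ • a`
      -- `X (C' p)` computed
      have hXval : ((B * C - C * B) * B - B * (B * C - C * B)) (C' p) = (2 * c₁ * c₂) • a := by
        rw [hX2, LinearMap.smul_apply, Module.End.mul_apply, Module.End.mul_apply, ← hc₁, map_smul, map_smul, ← hc₂,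
          smul_smul, smul_smul]
      -- `X (C' p) ∈ ℓ'` (raising operator on `C'(P)`) and `∈ ℓ`, hence `0`
      have hXℓ' := hℓ' _ hX hΘX hXΘ p hp
      rw [hXval] at hXℓ'
      have hzero : (2 * c₁ * c₂) • a = 0 := hmeet _ hXℓ' (Submodule.smul_mem _ _ (Submodule.mem_span_singleton_self a))
      rw [smul_eq_zero] at hzero
      rcases hzero with h | h
      · have hc₂0 : c₂ ≠ 0 := by rintro rfl; exact hBCa' (by rw [← hc₂, zero_smul])
        have hc₁0 : c₁ = 0 := by
          have : (2 : ℂ) * c₁ = 0 := (mul_eq_zero.1 h).resolve_right hc₂0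
          exact (mul_eq_zero.1 this).resolve_left two_ne_zero
        rw [← hc₁, hc₁0, zero_smul]
      · exact absurd h ha0
  -- (4): a vector space is not the union of two proper subspaces
  have hCa'Q : C a' ∈ Q := hlower_into C hΘC a'
  have hCa'0 : C a' ≠ 0 := fun h => ha'0 (hCinj a' ha'P h)
  have hC'p₀Q : C' p₀ ∈ Q := hlower_into C' hΘC' p₀
  have hC'p₀0 : C' p₀ ≠ 0 := fun h => hp₀0 (hC'inj p₀ hp₀P h)
  obtain ⟨B₁, hB₁, hΘB₁, hB₁Θ, hB₁v⟩ := h1b (C a') hCa'Q hCa'0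
  obtain ⟨B₂, hB₂, hΘB₂, hB₂Θ, hB₂v⟩ := h1b (C' p₀) hC'p₀Q hC'p₀0
  -- cleaner: case on the dichotomy for `B₁`, `B₂`, `B₁ + B₂`
  rcases hkey B₂ hB₂ hΘB₂ hB₂Θ with hB₂a | hB₂P
  · rcases hkey B₁ hB₁ hΘB₁ hB₁Θ with hB₁a | hB₁P
    · exact hB₁v hB₁a
    · -- `B₁ + B₂`
      have hsum := hkey (B₁ + B₂) (Submodule.add_mem _ hB₁ hB₂) (by rw [mul_add, hΘB₁, hΘB₂])
        (by rw [add_mul, hB₁Θ, hB₂Θ, neg_add])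
      rcases hsum with h | h
      · rw [LinearMap.add_apply, hB₂a, add_zero] at h
        exact hB₁v h
      · have h' := h p₀ hp₀P
        rw [LinearMap.add_apply, hB₁P p₀ hp₀P, zero_add] at h'
        exact hB₂v h'
  · exact hB₂v (hB₂P p₀ hp₀P)

/-- **RANK-TWO IDEMPOTENTS EXIST in the `(2,4)` core** (appended): for `W` irreducible under a bracket-closed `𝔊 ∋ 1, Θ` with
`dim P = 2`, `dim Q = 4`, there is an idempotent `E ∈ 𝔊` of rank two, vanishing on `P` and with values in `Q` — a full-rank pair
(`exists_fullRank_pair_two`) fed into `UnitaryThetaCore.exists_idempotent_of_fullRank_pair` with `r = 2`.  These projectors onto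
planes of `Q` are the objects of the open dichotomy of the `(2,4)` core (ruling planes of the skeleton `𝔰𝔩₂⊗1 ⊕ 1⊗𝔰𝔩₃` versus
two planes meeting in a line). [cite: Ribet1983, Thm. 3] [cite: MoonenZarhin1999LowDim, §2 (2.3)–(2.4)] -/
theorem UnitaryThetaCore.exists_rankTwo_idempotent_two_four [FiniteDimensional ℂ W] {𝔊 : Submodule ℂ (Module.End ℂ W)}
    (hbr : ∀ Y ∈ 𝔊, ∀ Z ∈ 𝔊, Y * Z - Z * Y ∈ 𝔊) (h1 : (1 : Module.End ℂ W) ∈ 𝔊)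
    (hirr : ∀ U : Submodule ℂ W, (∀ A ∈ 𝔊, ∀ u ∈ U, A u ∈ U) → U = ⊥ ∨ U = ⊤)
    {Θ : Module.End ℂ W} (hΘ : Θ ∈ 𝔊) (hΘΘ : Θ * Θ = 1)
    {P Q : Submodule ℂ W} (hP : ∀ x, x ∈ P ↔ Θ x = x) (hQ : ∀ x, x ∈ Q ↔ Θ x = -x)
    (hP2 : Module.finrank ℂ P = 2) (hQ4 : Module.finrank ℂ Q = 4) :
    ∃ E ∈ 𝔊, E * E = E ∧ (∀ p ∈ P, E p = 0) ∧ (∀ w, E w ∈ Q) ∧ Module.finrank ℂ (LinearMap.range E) = 2 := by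
  obtain ⟨B, hB, C, hC, hΘB, hBΘ, hΘC, hCΘ, hinj⟩ :=
    UnitaryThetaCore.exists_fullRank_pair_two hbr hirr hΘ hΘΘ hP hQ hP2 (by omega)
  obtain ⟨E, hE, hEE, hEP, hEQ, -, -, hrk⟩ :=
    UnitaryThetaCore.exists_idempotent_of_fullRank_pair hbr h1 hΘ hΘΘ hP hQ (r := 2) (by omega) hB hC hΘB hBΘ hΘC hCΘ hinj
  exact ⟨E, hE, hEE, hEP, hEQ, hrk⟩

end FullRank

end HodgeStructure

end Literature.AlgebraicGeometry.Motives

end
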